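import Literature.Analysis.OperatorTheory.DiagonalPerturbationEigenbasis
import HarnessLib

/-!
# Spectral projections in an eigenbasis: products, dominated convergence, basis-independence

Topic `Literature/Analysis/OperatorTheory`; continues `DiagonalPerturbationEigenbasis.lean`
(the bounded diagonal operators `basisDiag e r` of a Hilbert basis `e`). For a compact self-adjoint
operator given with an eigenbasis (`K e_i = κ_i e_i`), the spectral projection onto the part of the
spectrum in a set `J` is `E_J = diag(1_J ∘ κ)` (Reed–Simon I, Thm. VII.2 / §VII.1: the functional
calculus of a self-adjoint operator is diagonal in an eigenbasis, `f(K) e_i = f(κ_i) e_i`). We prove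
the pieces used to **keep the dependence on the choice of eigenbasis and on a parameter under
control**:

* `diag_diag` — `diag r (diag s x) = diag (r s) x` (the calculus is multiplicative);
* `hasSum_norm_sq_diag` — `‖diag r x‖² = Σ |r_i|² |⟨e_i, x⟩|²`;
* **`tendsto_diag_of_tendsto`** — dominated convergence: `r_n → r` pointwise with `|r_n| ≤ C`
  implies `diag r_n x → diag r x` (Tannery);
* `specProj e κ J = diag(1_J ∘ κ)`, idempotent, self-adjoint, `specProj e κ J (e i) = 1_J(κ_i) e_i`;
* **`specProj_eq_of_eigenbasis`** — basis-independence: if `f` is another Hilbert basis of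
  eigenvectors of `K = diag_e(κ)` (`K f_j = μ_j f_j`), then `specProj e κ J = specProj f μ J`.

## References

* M. Reed, B. Simon, *Methods of Modern Mathematical Physics I* (1980), §VII.1, Thm. VII.2.
  [ReedSimonI1980]
-/

noncomputable section

open Filter Topology Set ContinuousLinearMap
open scoped InnerProductSpace ComplexConjugate ENNReal

namespace Literature.Analysis.OperatorTheory

variable {ι : Type*} {𝕜 : Type*} [RCLike 𝕜]
variable {H : Type*} [NormedAddCommGroup H] [InnerProductSpace 𝕜 H]
variable {e : HilbertBasis ι 𝕜 H}
variable {r s : ι → 𝕜} {C C' : ℝ} {hr : ∀ i, ‖r i‖ ≤ C} {hs : ∀ i, ‖s i‖ ≤ C'}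

/-! ### Products and norms -/

/-- A pointwise bound for the product sequence. [folklore] -/
theorem norm_mul_le_mul (hr : ∀ i, ‖r i‖ ≤ C) (hs : ∀ i, ‖s i‖ ≤ C') (i : ι) :
    ‖r i * s i‖ ≤ C * C' := by
  rw [norm_mul]
  exact mul_le_mul (hr i) (hs i) (norm_nonneg _) ((norm_nonneg _).trans (hr i))

/-- **`diag r (diag s x) = diag (r·s) x`.** [cite: ReedSimonI1980, Thm. VII.2] -/
theorem diag_diag (x : H) :
    basisDiag e r C hr (basisDiag e s C' hs x) =
      basisDiag e (fun i ↦ r i * s i) (C * C') (norm_mul_le_mul hr hs) x := by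
  refine e.ext_inner fun i ↦ ?_
  rw [inner_basis_diag, inner_basis_diag, inner_basis_diag, mul_assoc]

/-- **`‖diag r x‖² = Σ_i |r_i|² |⟨e_i, x⟩|²`.** [folklore] -/
theorem hasSum_norm_sq_diag (x : H) :
    HasSum (fun i ↦ ‖r i‖ ^ 2 * ‖⟪e i, x⟫_𝕜‖ ^ 2) (‖basisDiag e r C hr x‖ ^ 2) := by
  have h2 : (0 : ℝ) < (2 : ℝ≥0∞).toReal := by norm_num
  have h := lp.hasSum_norm h2 (e.repr (basisDiag e r C hr x))
  rw [LinearIsometryEquiv.norm_map] at h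
  simp only [ENNReal.toReal_ofNat, Real.rpow_two] at h
  convert h using 1
  funext i
  rw [repr_diag, HilbertBasis.repr_apply_apply, norm_mul, mul_pow]

/-! ### Dominated convergence -/

/-- **Dominated convergence for diagonal operators**: if `r_n → r` pointwise and `|r_n i| ≤ C`,
then `diag r_n x → diag r x` for every `x`. [folklore] -/
theorem tendsto_diag_of_tendsto {rn : ℕ → ι → 𝕜} {hrn : ∀ n i, ‖rn n i‖ ≤ C}
    (hlim : ∀ i, Tendsto (fun n ↦ rn n i) atTop (𝓝 (r i))) (x : H) :
    Tendsto (fun n ↦ basisDiag e (rn n) C (hrn n) x) atTop (𝓝 (basisDiag e r C hr x)) := by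
  have hC : ∀ i, ‖r i‖ ≤ C := hr
  -- the squared distance as a series
  have hdiff : ∀ n, basisDiag e (rn n) C (hrn n) x - basisDiag e r C hr x =
      basisDiag e (fun i ↦ rn n i - r i) (C + C)
        (fun i ↦ (norm_sub_le _ _).trans (add_le_add (hrn n i) (hC i))) x := fun n ↦ by
    have h := congrArg (fun T : H →L[𝕜] H ↦ T x) (diag_sub_diag (e := e) (hr := hrn n) (hr' := hr))
    exact h
  have hsq : ∀ n, HasSum (fun i ↦ ‖rn n i - r i‖ ^ 2 * ‖⟪e i, x⟫_𝕜‖ ^ 2)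
      (‖basisDiag e (rn n) C (hrn n) x - basisDiag e r C hr x‖ ^ 2) := fun n ↦ by
    rw [hdiff n]; exact hasSum_norm_sq_diag x
  -- Tannery
  have hx : Summable fun i ↦ ‖⟪e i, x⟫_𝕜‖ ^ 2 := by
    have h := hasSum_norm_sq_diag (e := e) (r := fun _ ↦ (1 : 𝕜)) (C := 1) (hr := fun _ ↦ by simp) x
    simpa using h.summable
  have hlim0 : Tendsto (fun n ↦ ∑' i, ‖rn n i - r i‖ ^ 2 * ‖⟪e i, x⟫_𝕜‖ ^ 2) atTop
      (𝓝 (∑' i, (0 : ℝ) * ‖⟪e i, x⟫_𝕜‖ ^ 2)) := by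
    refine tendsto_tsum_of_dominated_convergence (bound := fun i ↦ (C + C) ^ 2 * ‖⟪e i, x⟫_𝕜‖ ^ 2)
      (hx.mul_left _) (fun i ↦ ?_) ?_
    · have h1 : Tendsto (fun n ↦ rn n i - r i) atTop (𝓝 0) := by
        simpa using (hlim i).sub_const (r i)
      have h2 : Tendsto (fun n ↦ ‖rn n i - r i‖ ^ 2) atTop (𝓝 0) := by
        simpa using (tendsto_norm_zero.comp h1).pow 2
      simpa using h2.mul_const (‖⟪e i, x⟫_𝕜‖ ^ 2)
    · refine Eventually.of_forall fun n i ↦ ?_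
      rw [Real.norm_eq_abs, abs_of_nonneg (by positivity)]
      refine mul_le_mul_of_nonneg_right (pow_le_pow_left₀ (norm_nonneg _) ?_ 2) (by positivity)
      exact (norm_sub_le _ _).trans (add_le_add (hrn n i) (hC i))
  simp only [zero_mul, tsum_zero] at hlim0
  have hnorm : Tendsto (fun n ↦ ‖basisDiag e (rn n) C (hrn n) x - basisDiag e r C hr x‖ ^ 2) atTop
      (𝓝 0) := by
    refine hlim0.congr fun n ↦ (hsq n).tsum_eq
  have hnorm' : Tendsto (fun n ↦ ‖basisDiag e (rn n) C (hrn n) x - basisDiag e r C hr x‖) atTop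
      (𝓝 0) := by
    have h := (Real.continuous_sqrt.tendsto 0).comp hnorm
    rw [Real.sqrt_zero] at h
    refine h.congr fun n ↦ ?_
    simp only [Function.comp_apply, Real.sqrt_sq (norm_nonneg _)]
  exact tendsto_iff_norm_sub_tendsto_zero.2 hnorm'

/-! ### Spectral projections -/

section SpecProj

variable (e)

open Classical in
/-- **The spectral projection** `E_J = diag(1_J ∘ κ)` of the diagonal operator `diag κ` onto the
levels in `J`. [cite: ReedSimonI1980, §VII.1] -/
def specProj (κ : ι → ℝ) (J : Set ℝ) : H →L[𝕜] H :=
  basisDiag e (fun i ↦ if κ i ∈ J then (1 : 𝕜) else 0) 1 (fun i ↦ by split_ifs <;> simp)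

variable {e} {κ : ι → ℝ} {J : Set ℝ}

open Classical in
/-- Coefficients of the spectral projection. [folklore] -/
theorem inner_basis_specProj (x : H) (i : ι) :
    ⟪e i, specProj e κ J x⟫_𝕜 = (if κ i ∈ J then (1 : 𝕜) else 0) * ⟪e i, x⟫_𝕜 :=
  inner_basis_diag x i

open Classical in
/-- On the basis: `E_J e_i = 1_J(κ_i) e_i`. [folklore] -/
theorem specProj_basis (i : ι) : specProj e κ J (e i) = (if κ i ∈ J then (1 : 𝕜) else 0) • e i :=
  diag_basis i

/-- `E_J` is idempotent. [folklore] -/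
theorem specProj_specProj (x : H) : specProj e κ J (specProj e κ J x) = specProj e κ J x := by
  classical
  refine e.ext_inner fun i ↦ ?_
  rw [inner_basis_specProj, inner_basis_specProj]
  split_ifs <;> simp

/-- `E_J` is self-adjoint (complete `H`). [folklore] -/
theorem isSelfAdjoint_specProj [CompleteSpace H] : IsSelfAdjoint (specProj e κ J : H →L[𝕜] H) := by
  classical
  refine isSelfAdjoint_diag fun i ↦ ?_
  split_ifs <;> simp

/-- `‖E_J x‖ ≤ ‖x‖`. [folklore] -/
theorem norm_specProj_le (x : H) : ‖specProj e κ J x‖ ≤ ‖x‖ := by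
  classical
  have h := norm_diag_le (e := e) (r := fun i ↦ if κ i ∈ J then (1 : 𝕜) else 0) (C := 1)
    (hr := fun i ↦ by split_ifs <;> simp) zero_le_one (fun i ↦ by split_ifs <;> simp)
  calc ‖specProj e κ J x‖ ≤ ‖(specProj e κ J : H →L[𝕜] H)‖ * ‖x‖ := le_opNorm _ _
    _ ≤ 1 * ‖x‖ := mul_le_mul_of_nonneg_right h (norm_nonneg _)
    _ = ‖x‖ := one_mul _

open Classical in
/-- **Parseval for the projection**: `‖E_J x‖² = Σ_{κ_i ∈ J} |⟨e_i, x⟩|²`. [folklore] -/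
theorem hasSum_norm_sq_specProj (x : H) :
    HasSum (fun i ↦ if κ i ∈ J then ‖⟪e i, x⟫_𝕜‖ ^ 2 else 0) (‖specProj e κ J x‖ ^ 2) := by
  have h := hasSum_norm_sq_diag (e := e) (r := fun i ↦ if κ i ∈ J then (1 : 𝕜) else 0) (C := 1)
    (hr := fun i ↦ by split_ifs <;> simp) x
  convert h using 1
  · funext i
    split_ifs <;> simp
  · rfl

/-! ### Independence of the eigenbasis -/

/-- **Eigenvectors of `diag κ` have coefficients supported on one level**: if
`diag κ v = μ v` then `⟨e_i, v⟩ = 0` whenever `κ_i ≠ μ`. [cite: ReedSimonI1980, Thm. VII.2] -/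
theorem inner_basis_eq_zero_of_eigen {Cκ : ℝ} {hκ : ∀ i, ‖(κ i : 𝕜)‖ ≤ Cκ} {v : H} {μ : ℝ}
    (hv : basisDiag e (fun i ↦ (κ i : 𝕜)) Cκ hκ v = (μ : 𝕜) • v) {i : ι} (hi : κ i ≠ μ) :
    ⟪e i, v⟫_𝕜 = 0 := by
  have h := congrArg (fun w ↦ ⟪e i, w⟫_𝕜) hv
  simp only [inner_basis_diag, inner_smul_right] at h
  have h' : ((κ i : 𝕜) - μ) * ⟪e i, v⟫_𝕜 = 0 := by rw [sub_mul, h, sub_self]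
  rcases mul_eq_zero.1 h' with h0 | h0
  · exact absurd (by exact_mod_cast sub_eq_zero.1 h0) hi
  · exact h0

/-- **Basis-independence of the spectral projections.** Let `f` be another Hilbert basis of `H`
consisting of eigenvectors of `K = diag_e(κ)`: `K f_j = μ_j f_j`. Then `E_J` computed in `e`
(levels `κ`) and in `f` (levels `μ`) agree. [cite: ReedSimonI1980, Thm. VII.2] -/
theorem specProj_eq_of_eigenbasis [CompleteSpace H] {ι' : Type*} (f : HilbertBasis ι' 𝕜 H)
    {μ : ι' → ℝ} {Cκ : ℝ} {hκ : ∀ i, ‖(κ i : 𝕜)‖ ≤ Cκ}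
    (hf : ∀ j, basisDiag e (fun i ↦ (κ i : 𝕜)) Cκ hκ (f j) = (μ j : 𝕜) • f j) (J : Set ℝ) :
    (specProj e κ J : H →L[𝕜] H) = specProj f μ J := by
  classical
  -- two bounded operators agreeing on the Hilbert basis `f`
  have hd : Dense (Submodule.span 𝕜 (Set.range f) : Set H) :=
    Submodule.dense_iff_topologicalClosure_eq_top.2 f.dense_span
  refine ContinuousLinearMap.ext_on hd ?_
  rintro _ ⟨j, rfl⟩
  rw [specProj_basis]
  -- compute `E_J^{(e)} f_j` coefficientwise
  refine e.ext_inner fun i ↦ ?_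
  rw [inner_basis_specProj, inner_smul_right]
  by_cases hij : κ i = μ j
  · rw [hij]
  · rw [inner_basis_eq_zero_of_eigen (hf j) hij, mul_zero, mul_zero]

end SpecProj

end Literature.Analysis.OperatorTheory
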